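import Summits.KontsevichZagierPeriods.KontsevichZagierPeriods.Theorems.LogPrimitiveNL.Negative.Defs

/-!
# Crux `LiouvilleUnfolding.LogPrimitiveNL` (stmt-KontsevichZagierPeriods-2836): load-bearing hypotheses

Negative-side (cdisprove) support, file 2/3 ("any proof must use H"). Dropping any one of
`hab` (`a ≤ b`), `hcont` (continuity of `Vᵢ` on the CLOSED fibre), `hderiv` (`Vᵢ'` is the
`t`-derivative) or `hdom` (the band equation) makes the crux FALSE: each time an explicit datum in
dimension `n = 0` (base the point `ℝ⁰`, band `⊂ ℝ¹`) satisfies every remaining hypothesis while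
`r.value ≠ r'.value`, which soundness of the calculus (`KZ.relations_le_ker_eval_holds`) forbids for a
relation.

* `not_withoutLe`: `a = 1 > 0 = b`, empty band, `V = exp t` vacuously admissible, `r' = [pt, −1]`.
* `not_withoutContinuousOn`: `k = 2`, `V₀` jumps `1 → 2` at the endpoint `t = 1` (`h₀ = 1`),
  `V₁ = 1 + t` (`h₁ = −1`) cancels the transcendental boundary term; `r = [[0,1], −1/(1+t)]`
  (value `−log 2`), `r' = [pt, 0]`.
* `not_withoutHasDerivAt`: `V = 1`, `V' = 1`; `r = [[0,1], 1]`, `r' = [pt, 0]`.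
* `not_withoutDomain`: `k = 0`; `r = [[5,6], step]` (integrand `0` on the would-be band `(0,1)`),
  `r' = [pt, 0]`.
The semialgebraicity hypotheses and termwise integrability are NOT load-bearing in this sense (file
3/3, `Bare`).
-/

noncomputable section

open Set MeasureTheory
open Literature.NumberTheory.Transcendental

namespace Summit.KontsevichZagierPeriods.LiouvilleUnfolding.LogPrimitiveNL.Negative

open Summit.KontsevichZagierPeriods.KontsevichZagierPeriods.Theses.LiouvilleUnfolding (LogPrimitiveNL)

/-- The crux with `a ≤ b` on the base DROPPED. -/
def WithoutLe : Prop :=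
  ∀ (n k : ℕ) (r : KZ.IntegralRep (n + 1)) (r' : KZ.IntegralRep n) (a b : (Fin n → ℝ) → ℝ)
    (h : Fin k → (Fin n → ℝ) → ℝ) (V V' : Fin k → (Fin (n + 1) → ℝ) → ℝ),
    IsSemialgebraicFunOn ℚ r'.domain a →
    IsSemialgebraicFunOn ℚ r'.domain b →
    r.domain = {z | (Fin.init z : Fin n → ℝ) ∈ r'.domain ∧ a (Fin.init z) ≤ z (Fin.last n) ∧
      z (Fin.last n) ≤ b (Fin.init z)} →
    (∀ i, IsSemialgebraicFunOn ℚ r'.domain (h i)) →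
    (∀ i, IsSemialgebraicFunOn ℚ r.domain (V i)) →
    (∀ i, ∀ z ∈ r.domain, 0 < V i z) →
    (∀ i, ∀ x ∈ r'.domain, ContinuousOn (fun t : ℝ => V i (Fin.snoc x t)) (Icc (a x) (b x))) →
    (∀ i, ∀ x ∈ r'.domain, ∀ t ∈ Ioo (a x) (b x),
      HasDerivAt (fun s : ℝ => V i (Fin.snoc x s)) (V' i (Fin.snoc x t)) t) →
    (∀ i, IntegrableOn (fun z => h i (Fin.init z) * V' i z / V i z) r.domain) →
    (∀ x ∈ r'.domain, ∀ t ∈ Ioo (a x) (b x),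
      r.integrand (Fin.snoc x t) = ∑ i, h i x * V' i (Fin.snoc x t) / V i (Fin.snoc x t)) →
    (∀ x ∈ r'.domain, r'.integrand x =
      ∑ i, h i x * (Real.log (V i (Fin.snoc x (b x))) - Real.log (V i (Fin.snoc x (a x))))) →
    KZ.of r - KZ.of r' ∈ KZ.relations

/-- The crux with continuity of `Vᵢ` on the CLOSED fibres DROPPED. -/
def WithoutContinuousOn : Prop :=
  ∀ (n k : ℕ) (r : KZ.IntegralRep (n + 1)) (r' : KZ.IntegralRep n) (a b : (Fin n → ℝ) → ℝ)
    (h : Fin k → (Fin n → ℝ) → ℝ) (V V' : Fin k → (Fin (n + 1) → ℝ) → ℝ),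
    IsSemialgebraicFunOn ℚ r'.domain a →
    IsSemialgebraicFunOn ℚ r'.domain b →
    (∀ x ∈ r'.domain, a x ≤ b x) →
    r.domain = {z | (Fin.init z : Fin n → ℝ) ∈ r'.domain ∧ a (Fin.init z) ≤ z (Fin.last n) ∧
      z (Fin.last n) ≤ b (Fin.init z)} →
    (∀ i, IsSemialgebraicFunOn ℚ r'.domain (h i)) →
    (∀ i, IsSemialgebraicFunOn ℚ r.domain (V i)) →
    (∀ i, ∀ z ∈ r.domain, 0 < V i z) →
    (∀ i, ∀ x ∈ r'.domain, ∀ t ∈ Ioo (a x) (b x),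
      HasDerivAt (fun s : ℝ => V i (Fin.snoc x s)) (V' i (Fin.snoc x t)) t) →
    (∀ i, IntegrableOn (fun z => h i (Fin.init z) * V' i z / V i z) r.domain) →
    (∀ x ∈ r'.domain, ∀ t ∈ Ioo (a x) (b x),
      r.integrand (Fin.snoc x t) = ∑ i, h i x * V' i (Fin.snoc x t) / V i (Fin.snoc x t)) →
    (∀ x ∈ r'.domain, r'.integrand x =
      ∑ i, h i x * (Real.log (V i (Fin.snoc x (b x))) - Real.log (V i (Fin.snoc x (a x))))) →
    KZ.of r - KZ.of r' ∈ KZ.relations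

/-- The crux with the fibrewise derivative hypothesis (`Vᵢ'` is the `t`-derivative of `Vᵢ`) DROPPED. -/
def WithoutHasDerivAt : Prop :=
  ∀ (n k : ℕ) (r : KZ.IntegralRep (n + 1)) (r' : KZ.IntegralRep n) (a b : (Fin n → ℝ) → ℝ)
    (h : Fin k → (Fin n → ℝ) → ℝ) (V V' : Fin k → (Fin (n + 1) → ℝ) → ℝ),
    IsSemialgebraicFunOn ℚ r'.domain a →
    IsSemialgebraicFunOn ℚ r'.domain b →
    (∀ x ∈ r'.domain, a x ≤ b x) →
    r.domain = {z | (Fin.init z : Fin n → ℝ) ∈ r'.domain ∧ a (Fin.init z) ≤ z (Fin.last n) ∧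
      z (Fin.last n) ≤ b (Fin.init z)} →
    (∀ i, IsSemialgebraicFunOn ℚ r'.domain (h i)) →
    (∀ i, IsSemialgebraicFunOn ℚ r.domain (V i)) →
    (∀ i, ∀ z ∈ r.domain, 0 < V i z) →
    (∀ i, ∀ x ∈ r'.domain, ContinuousOn (fun t : ℝ => V i (Fin.snoc x t)) (Icc (a x) (b x))) →
    (∀ i, IntegrableOn (fun z => h i (Fin.init z) * V' i z / V i z) r.domain) →
    (∀ x ∈ r'.domain, ∀ t ∈ Ioo (a x) (b x),
      r.integrand (Fin.snoc x t) = ∑ i, h i x * V' i (Fin.snoc x t) / V i (Fin.snoc x t)) →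
    (∀ x ∈ r'.domain, r'.integrand x =
      ∑ i, h i x * (Real.log (V i (Fin.snoc x (b x))) - Real.log (V i (Fin.snoc x (a x))))) →
    KZ.of r - KZ.of r' ∈ KZ.relations

/-- The crux with the band equation `r.domain = {(x,t) | x ∈ τ, a x ≤ t ≤ b x}` DROPPED. -/
def WithoutDomain : Prop :=
  ∀ (n k : ℕ) (r : KZ.IntegralRep (n + 1)) (r' : KZ.IntegralRep n) (a b : (Fin n → ℝ) → ℝ)
    (h : Fin k → (Fin n → ℝ) → ℝ) (V V' : Fin k → (Fin (n + 1) → ℝ) → ℝ),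
    IsSemialgebraicFunOn ℚ r'.domain a →
    IsSemialgebraicFunOn ℚ r'.domain b →
    (∀ x ∈ r'.domain, a x ≤ b x) →
    (∀ i, IsSemialgebraicFunOn ℚ r'.domain (h i)) →
    (∀ i, IsSemialgebraicFunOn ℚ r.domain (V i)) →
    (∀ i, ∀ z ∈ r.domain, 0 < V i z) →
    (∀ i, ∀ x ∈ r'.domain, ContinuousOn (fun t : ℝ => V i (Fin.snoc x t)) (Icc (a x) (b x))) →
    (∀ i, ∀ x ∈ r'.domain, ∀ t ∈ Ioo (a x) (b x),
      HasDerivAt (fun s : ℝ => V i (Fin.snoc x s)) (V' i (Fin.snoc x t)) t) →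
    (∀ i, IntegrableOn (fun z => h i (Fin.init z) * V' i z / V i z) r.domain) →
    (∀ x ∈ r'.domain, ∀ t ∈ Ioo (a x) (b x),
      r.integrand (Fin.snoc x t) = ∑ i, h i x * V' i (Fin.snoc x t) / V i (Fin.snoc x t)) →
    (∀ x ∈ r'.domain, r'.integrand x =
      ∑ i, h i x * (Real.log (V i (Fin.snoc x (b x))) - Real.log (V i (Fin.snoc x (a x))))) →
    KZ.of r - KZ.of r' ∈ KZ.relations

section Witnesses

open Literature.ModelTheory.ExponentialFields (isSemialgebraic_univ)

/-! ### (a) `a ≤ b` is load-bearing -/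

/-- The band `[1, 0]` is empty. -/
theorem not_mem_band1_one_zero (z : Fin 1 → ℝ) : z ∉ band1 1 0 := fun hz => by
  have h := mem_band1.1 hz
  linarith [h.1, h.2]

/-- The band `[1, 0]` is empty (as a set equation). -/
theorem band1_one_zero_eq_empty : band1 (1 : ℝ) 0 = ∅ :=
  Set.subset_empty_iff.mp fun z hz => (not_mem_band1_one_zero z hz).elim

/-- `[1, 0] ⊂ ℝ¹` is `ℚ`-semialgebraic. -/
theorem isSemialgebraic_band1_one_zero :
    Literature.ModelTheory.ExponentialFields.IsSemialgebraic ℚ (band1 (1 : ℝ) 0) := by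
  simpa using isSemialgebraic_band1 1 0

/-- `[[1, 0], 0]`: the EMPTY band over the point (edges `a = 1 > 0 = b`), value `0`. -/
def emptyBandRep : KZ.IntegralRep 1 :=
  bandRep 1 0 isSemialgebraic_band1_one_zero (fun _ => 0)
    ((isSemialgebraicFunOn_const isSemialgebraic_band1_one_zero 0).congr fun _ _ => by simp)
    continuousOn_const

/-- The empty band represents `0`. -/
theorem value_emptyBandRep : emptyBandRep.value = 0 := by
  simp [KZ.IntegralRep.value, emptyBandRep]

/-- **`a ≤ b` cannot be dropped.** Witness: base `ℝ⁰`, `a = 1`, `b = 0` (empty band, `[r] = [∅, 0]`),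
`k = 1`, `h = 1`, `V = exp t` (vacuously semialgebraic on the empty band), so that
`r'.integrand = log V(·,0) − log V(·,1) = −1` is rational: `r' = [pt, −1]`, `r.value = 0 ≠ −1`.
(With `a ≤ b` the band is non-empty, `V` must be semialgebraic there, and `exp` is excluded.) -/
theorem not_withoutLe : ¬ WithoutLe := by
  intro H
  have hmem := H 0 1 emptyBandRep (ptRep (-1)) (fun _ => 1) (fun _ => 0) (fun _ _ => 1)
    (fun _ z => Real.exp (z 0)) (fun _ z => Real.exp (z 0))
    ((isSemialgebraicFunOn_const isSemialgebraic_univ 1).congr fun _ _ => by simp)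
    ((isSemialgebraicFunOn_const isSemialgebraic_univ 0).congr fun _ _ => by simp)
    rfl
    (fun _ => (isSemialgebraicFunOn_const isSemialgebraic_univ 1).congr fun _ _ => by simp)
    (fun _ => (isSemialgebraicFunOn_const isSemialgebraic_band1_one_zero 0).congr
      fun z hz => (not_mem_band1_one_zero z hz).elim)
    (fun _ z _ => Real.exp_pos _)
    (fun _ x _ => by
      simpa only [snoc_fin_one_apply_zero] using Real.continuous_exp.continuousOn)
    (fun _ x _ t ht => by
      simp only [mem_Ioo] at ht
      exact absurd (ht.1.trans ht.2) (by norm_num))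
    (fun _ => by
      rw [show emptyBandRep.domain = ∅ from band1_one_zero_eq_empty]
      exact integrableOn_empty)
    (fun x _ t ht => by
      simp only [mem_Ioo] at ht
      exact absurd (ht.1.trans ht.2) (by norm_num))
    (fun x _ => by simp)
  have hv := value_eq_of_sub_mem_relations hmem
  rw [value_emptyBandRep, value_ptRep] at hv
  norm_num at hv

/-! ### (b) continuity of `Vᵢ` on the CLOSED fibre is load-bearing -/

/-- `[0, 1] ⊂ ℝ¹` is `ℚ`-semialgebraic. -/
theorem isSemialgebraic_band1_zero_one :
    Literature.ModelTheory.ExponentialFields.IsSemialgebraic ℚ (band1 (0 : ℝ) 1) := by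
  simpa using isSemialgebraic_band1 0 1

/-- The jump: `V = 1` on `{t < 1}`, `V = 2` on `{1 ≤ t}` (so `V(·, b) = 2` at the endpoint `b = 1`). -/
def jumpV (z : Fin 1 → ℝ) : ℝ := if z 0 < 1 then 1 else 2

/-- The jump function is `ℚ`-semialgebraic on `[0, 1]` (piecewise constant on a semialgebraic
split). -/
theorem isSemialgebraicFunOn_jumpV : IsSemialgebraicFunOn ℚ (band1 (0 : ℝ) 1) jumpV := by
  have h1 : Literature.ModelTheory.ExponentialFields.IsSemialgebraic ℚ {z : Fin 1 → ℝ | z 0 < 1} := by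
    simpa using Literature.ModelTheory.ExponentialFields.isSemialgebraic_setOf_eval_lt (k := ℚ)
      (R := ℝ) (MvPolynomial.X 0 : MvPolynomial (Fin 1) ℚ) (1 : MvPolynomial (Fin 1) ℚ)
  have h2 : Literature.ModelTheory.ExponentialFields.IsSemialgebraic ℚ {z : Fin 1 → ℝ | 1 ≤ z 0} := by
    simpa using Literature.ModelTheory.ExponentialFields.isSemialgebraic_setOf_eval_le (k := ℚ)
      (R := ℝ) (1 : MvPolynomial (Fin 1) ℚ) (MvPolynomial.X 0 : MvPolynomial (Fin 1) ℚ)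
  have hu : band1 (0 : ℝ) 1 = (band1 0 1 ∩ {z | z 0 < 1}) ∪ (band1 0 1 ∩ {z | 1 ≤ z 0}) := by
    ext z
    simp only [mem_union, mem_inter_iff, mem_setOf_eq]
    rcases lt_or_ge (z 0) 1 with h | h <;> tauto
  rw [hu]
  refine IsSemialgebraicFunOn.union
    (isSemialgebraicFunOn_const (isSemialgebraic_band1_zero_one.inter h1) 1)
    (isSemialgebraicFunOn_const (isSemialgebraic_band1_zero_one.inter h2) 2) ?_ ?_
  · intro z hz
    have : z 0 < 1 := hz.2
    simp [jumpV, this]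
  · intro z hz
    have : ¬ z 0 < 1 := not_lt.2 hz.2
    simp [jumpV, this]

/-- `[[0, 1], −1/(1+t)]`, value `−log 2`. -/
def logTwoRep : KZ.IntegralRep 1 :=
  bandRep 0 1 isSemialgebraic_band1_zero_one (fun z => -1 / (1 + z 0))
    ((isSemialgebraicFunOn_aeval_div_aeval isSemialgebraic_band1_zero_one (MvPolynomial.C (-1))
        (1 + MvPolynomial.X 0) fun z hz => by
          have h := (mem_band1.1 hz).1
          simp only [map_add, map_one, MvPolynomial.aeval_X]
          intro h0; linarith).congr
      fun z _ => by simp)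
    (continuousOn_const.div (continuousOn_const.add (continuous_apply 0).continuousOn)
      fun z hz => by have h := (mem_band1.1 hz).1; intro h0; linarith)

/-- `[[0,1], −1/(1+t)]` represents `−log 2`. -/
theorem value_logTwoRep : logTwoRep.value = -Real.log 2 := by
  have hfc : ContinuousOn (fun t : ℝ => -Real.log (1 + t)) (Icc 0 1) :=
    ((continuousOn_const.add continuousOn_id).log fun t ht h0 => by
      simp only [Pi.add_apply, id_eq] at h0
      linarith [ht.1]).neg
  have hfd : ∀ (x : Fin 0 → ℝ), ∀ t ∈ Ioo (0 : ℝ) 1,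
      HasDerivAt (fun t : ℝ => -Real.log (1 + t)) (-1 / (1 + (Fin.snoc x t : Fin 1 → ℝ) 0)) t := by
    intro x t ht
    have h1 : (1 : ℝ) + t ≠ 0 := by have := ht.1; intro h0; linarith
    have hd : HasDerivAt (fun s : ℝ => -Real.log (1 + s)) (-(1 / (1 + t))) t :=
      (((hasDerivAt_id' t).const_add (1 : ℝ)).log h1).neg
    rw [snoc_fin_one_apply_zero]
    convert hd using 1
    ring
  have e : logTwoRep.value = ∫ z in band1 (0 : ℝ) 1, -1 / (1 + z 0) := rfl
  rw [e, setIntegral_band1_eq (G := fun z : Fin 1 → ℝ => -1 / (1 + z 0)) zero_le_one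
    logTwoRep.integrableOn hfc hfd]
  norm_num

/-- **Continuity on the closed fibre cannot be dropped.** Witness: base `ℝ⁰`, band `[0, 1]`,
`k = 2`: `V₀ = jumpV` (`= 1` on `[0,1)`, `= 2` at `t = 1`; `V₀' = 0` on the open fibre), `h₀ = 1`;
`V₁ = 1 + t`, `V₁' = 1`, `h₁ = −1`. Then `r.integrand = −1/(1+t)` on `(0,1)`, the boundary term is
`(log 2 − log 1) − (log 2 − log 1) = 0` (rational thanks to the jump): `r' = [pt, 0]`, while
`r.value = −log 2 ≠ 0`. A jump of `Vᵢ` at an endpoint shifts the boundary term by `hᵢ log(jump)`. -/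
theorem not_withoutContinuousOn : ¬ WithoutContinuousOn := by
  intro H
  have hmem := H 0 2 logTwoRep (ptRep 0) (fun _ => 0) (fun _ => 1) ![fun _ => 1, fun _ => -1]
    ![jumpV, fun z => 1 + z 0] ![fun _ => 0, fun _ => 1]
    ((isSemialgebraicFunOn_const isSemialgebraic_univ 0).congr fun _ _ => by simp)
    ((isSemialgebraicFunOn_const isSemialgebraic_univ 1).congr fun _ _ => by simp)
    (fun _ _ => zero_le_one)
    rfl
    (by
      refine Fin.forall_fin_two.2 ⟨?_, ?_⟩
      · exact (isSemialgebraicFunOn_const isSemialgebraic_univ 1).congr fun _ _ => by simp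
      · exact (isSemialgebraicFunOn_const isSemialgebraic_univ (-1)).congr fun _ _ => by simp)
    (by
      refine Fin.forall_fin_two.2 ⟨?_, ?_⟩
      · show IsSemialgebraicFunOn ℚ (band1 0 1) jumpV
        exact isSemialgebraicFunOn_jumpV
      · show IsSemialgebraicFunOn ℚ (band1 0 1) (fun z : Fin 1 → ℝ => 1 + z 0)
        exact (isSemialgebraicFunOn_aeval isSemialgebraic_band1_zero_one
          (1 + MvPolynomial.X 0 : MvPolynomial (Fin 1) ℚ)).congr fun z _ => by simp)
    (by
      refine Fin.forall_fin_two.2 ⟨fun z _ => ?_, fun z hz => ?_⟩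
      · simp only [Matrix.cons_val_zero, jumpV]
        split_ifs <;> norm_num
      · have h := (mem_band1.1 hz).1
        simp only [Matrix.cons_val_one]
        show (0 : ℝ) < 1 + z 0
        linarith)
    (by
      refine Fin.forall_fin_two.2 ⟨fun x _ t ht => ?_, fun x _ t ht => ?_⟩
      · simp only [mem_Ioo] at ht
        have hev : (fun s : ℝ => jumpV (Fin.snoc x s : Fin 1 → ℝ)) =ᶠ[nhds t] fun _ => (1 : ℝ) := by
          filter_upwards [Iio_mem_nhds ht.2] with s hs
          have hs' : s < 1 := hs
          simp [jumpV, hs']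
        simpa using (hasDerivAt_const t (1 : ℝ)).congr_of_eventuallyEq hev
      · simpa using ((hasDerivAt_id t).const_add (1 : ℝ)))
    (by
      refine Fin.forall_fin_two.2 ⟨?_, ?_⟩
      · simp
      · have hc : ContinuousOn (fun z : Fin 1 → ℝ => (-1 : ℝ) * 1 / (1 + z 0)) (band1 0 1) :=
          continuousOn_const.div (continuousOn_const.add (continuous_apply 0).continuousOn)
            fun z hz => by have h := (mem_band1.1 hz).1; intro h0; linarith
        show IntegrableOn (fun z : Fin 1 → ℝ => (-1 : ℝ) * 1 / (1 + z 0)) (band1 0 1)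
        exact hc.integrableOn_compact (isCompact_band1 0 1))
    (fun x _ t ht => by
      simp [logTwoRep, Fin.sum_univ_two, jumpV])
    (fun x _ => by
      norm_num [Fin.sum_univ_two, jumpV])
  have hv := value_eq_of_sub_mem_relations hmem
  rw [value_logTwoRep, value_ptRep] at hv
  have h2 := Real.log_pos one_lt_two
  simp at hv
  linarith

/-! ### (c) the derivative hypothesis is load-bearing -/

/-- `[[0, 1], 1]`, value `1`. -/
def oneRep : KZ.IntegralRep 1 :=
  bandRep 0 1 isSemialgebraic_band1_zero_one (fun _ => 1)
    ((isSemialgebraicFunOn_const isSemialgebraic_band1_zero_one 1).congr fun _ _ => by simp)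
    continuousOn_const

/-- `[[0,1], 1]` represents `1`. -/
theorem value_oneRep : oneRep.value = 1 := by
  have e : oneRep.value = ∫ z in band1 (0 : ℝ) 1, (1 : ℝ) := rfl
  rw [e, setIntegral_band1_eq (G := fun _ : Fin 1 → ℝ => (1 : ℝ)) (f := fun t => t) zero_le_one
    oneRep.integrableOn continuousOn_id (fun x t _ => hasDerivAt_id' t)]
  norm_num

/-- **The derivative hypothesis cannot be dropped.** Witness: base `ℝ⁰`, band `[0, 1]`, `k = 1`,
`h = 1`, `V = 1` but `V' = 1` (not the derivative of `V`): `r = [[0,1], 1]` (value `1`),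
`r' = [pt, log 1 − log 1] = [pt, 0]`. -/
theorem not_withoutHasDerivAt : ¬ WithoutHasDerivAt := by
  intro H
  have hmem := H 0 1 oneRep (ptRep 0) (fun _ => 0) (fun _ => 1) (fun _ _ => 1)
    (fun _ _ => 1) (fun _ _ => 1)
    ((isSemialgebraicFunOn_const isSemialgebraic_univ 0).congr fun _ _ => by simp)
    ((isSemialgebraicFunOn_const isSemialgebraic_univ 1).congr fun _ _ => by simp)
    (fun _ _ => zero_le_one)
    rfl
    (fun _ => (isSemialgebraicFunOn_const isSemialgebraic_univ 1).congr fun _ _ => by simp)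
    (fun _ => (isSemialgebraicFunOn_const isSemialgebraic_band1_zero_one 1).congr
      fun _ _ => by simp)
    (fun _ _ _ => one_pos)
    (fun _ _ _ => continuousOn_const)
    (fun _ => by
      show IntegrableOn (fun _ : Fin 1 → ℝ => (1 : ℝ) * 1 / 1) (band1 0 1)
      exact continuousOn_const.integrableOn_compact (isCompact_band1 0 1))
    (fun x _ t ht => by simp [oneRep])
    (fun x _ => by simp)
  have hv := value_eq_of_sub_mem_relations hmem
  rw [value_oneRep, value_ptRep] at hv
  norm_num at hv

/-! ### (d) the band equation is load-bearing (bookkeeping) -/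

/-- `[5, 6] ⊂ ℝ¹` is `ℚ`-semialgebraic. -/
theorem isSemialgebraic_band1_five_six :
    Literature.ModelTheory.ExponentialFields.IsSemialgebraic ℚ (band1 (5 : ℝ) 6) := by
  simpa using isSemialgebraic_band1 5 6

/-- The step `0` on `{t ≤ 1}`, `1` beyond. -/
def stepFun (z : Fin 1 → ℝ) : ℝ := if z 0 ≤ 1 then 0 else 1

/-- On `[5, 6]` the step function is `1`. -/
theorem stepFun_eq_one {z : Fin 1 → ℝ} (hz : z ∈ band1 (5 : ℝ) 6) : stepFun z = 1 := by
  have h := (mem_band1.1 hz).1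
  have : ¬ z 0 ≤ 1 := by intro h'; linarith
  simp [stepFun, this]

/-- `[[5, 6], stepFun] = [[5, 6], 1]`, value `1`; its integrand VANISHES on the would-be band `(0, 1)`. -/
def farRep : KZ.IntegralRep 1 :=
  bandRep 5 6 isSemialgebraic_band1_five_six stepFun
    (((isSemialgebraicFunOn_const isSemialgebraic_band1_five_six 1).congr fun _ _ => by simp).congr
      fun z hz => (stepFun_eq_one hz).symm)
    (continuousOn_const.congr fun z hz => stepFun_eq_one hz)

/-- `[[5,6], stepFun]` represents `1`. -/
theorem value_farRep : farRep.value = 1 := by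
  have e : farRep.value = ∫ z in band1 (5 : ℝ) 6, stepFun z := rfl
  rw [e, setIntegral_band1_eq (G := stepFun) (f := fun t => t) (by norm_num) farRep.integrableOn
    continuousOn_id (fun x t ht => by
      rw [stepFun_eq_one (snoc_mem_band1.2 (Ioo_subset_Icc_self ht))]
      exact hasDerivAt_id' t)]
  norm_num

/-- **The band equation cannot be dropped** (bookkeeping hypothesis). Witness with NO logarithm at
all (`k = 0`): `r = [[5, 6], stepFun]` has integrand `0` on the would-be band `(0, 1)` over the point
and value `1`, `r' = [pt, 0]`. -/
theorem not_withoutDomain : ¬ WithoutDomain := by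
  intro H
  have hmem := H 0 0 farRep (ptRep 0) (fun _ => 0) (fun _ => 1) (fun i => i.elim0)
    (fun i => i.elim0) (fun i => i.elim0)
    ((isSemialgebraicFunOn_const isSemialgebraic_univ 0).congr fun _ _ => by simp)
    ((isSemialgebraicFunOn_const isSemialgebraic_univ 1).congr fun _ _ => by simp)
    (fun _ _ => zero_le_one)
    (fun i => i.elim0) (fun i => i.elim0) (fun i => i.elim0) (fun i => i.elim0) (fun i => i.elim0)
    (fun i => i.elim0)
    (fun x _ t ht => by
      simp only [mem_Ioo] at ht
      have : t ≤ 1 := ht.2.le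
      simp [farRep, stepFun, this])
    (fun x _ => by simp)
  have hv := value_eq_of_sub_mem_relations hmem
  rw [value_farRep, value_ptRep] at hv
  norm_num at hv

end Witnesses


end Summit.KontsevichZagierPeriods.LiouvilleUnfolding.LogPrimitiveNL.Negative
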